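/-
Copyright: the b2b-balaban T⁴-continuum CRUX team, row NE7b OWNER lineage `t4-ne7b-p1` (gen 148). Project licence.
-/
import Summits.QuantumFields.BalabanUV.T4Continuum.Spine.NE7b.SupRemainderFlowInvariantBall

/-!
# HONEST POWER COUNTING OF THE WEIGHTED CLASS MAP AT `d = 4` — THE PER-STEP LETTERS `μ, C, ν` OF (436) READ OFF THE ONE-STEP FILES
# (SCOPING-d19 §D (2) = (d14)(3) proper, bookkeeping half; file (784)).  The one-step files (767)∕(769)∕(776)∕(772)∕(777)–(779)∕(773)∕
# (780)–(783) have, at every order `m ∈ {2,3,4,5}` and in every role, the shape «next letter ≤ T_m · B», with the WEIGHTED TRANSPORT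
# FACTOR `T_m = |t|^m · n · M^{m(m−1)∕2}` ((766)∕(768)∕(770)∕(771)∕(774)∕(775): exact power counting `|t|^m·n` times the block factor `M`
# of the weights once per edge of the full graph on `m` vertices) and `B` = the packaged fluctuation bound, AFFINE in the input letter of
# the same order with UNIT coefficient plus cross terms (other roles, same order, coefficients = h-letter × factor letters) plus a SOURCE
# free of that order's letters (products of lower-order letters, interpolated∕tree terms).  THIS FILE books what that says at `d = 4`
# under the canonical normalisation `t = L⁻¹`, `n = L⁴` of (431):
#   `T_2 = L²·M`, `T_3 = L·M³`, `T_4 = M⁶`, `T_5 = M¹⁰∕L`;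
# since the block factor is `M ≥ 1` (diagonal of the weights), NO order `≤ 4` contracts for ANY blocking `L` (orders 2, 3: factor `≥ L`,
# RELEVANT — extracted∕tuned per (432)∕(434)∕(435), never iterated; order 4: factor `≥ 1`, MARGINAL — the iterated bound is an affine
# recursion with rate `≥ 1` and positive source, UNBOUNDED: the quartic letter is the β-function's object, not this class map's), and
# order 5 contracts iff `M¹⁰·(1 + a) < L` (`a` = the total cross coefficient); there (436)'s recursion holds with `μ = T_5(1+a)`,
# `C = T_5·S`, `ν = 0` (no letter of order 5 enters its own bound twice), and (436) §2–§3 give the invariant ball `C∕(1−μ)` and the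
# attraction `μ^j` — GIVEN a uniform bound `S` on the source, i.e. GIVEN the lower orders' letters stay bounded (the relevant∕marginal
# flow — NOT claimed) (row NE7b, node U5c; (436) BY NAME; Mathlib; [folklore] real arithmetic).

Cell `pub-balaban`, sub-cell `t4`, spine estimate NE7b (`T4WeightBudget.RelWeightBound`; the cell's OWN estimate — NOT PRINTED in
[Bałaban 1983–89], NOT PROVED).  Crux-route work under `Spine/NE7b/` by the row OWNER (`t4-ne7b-p1` gen 148, file (784)) under FREEZE
(0)'s crux-prover clause; NOTHING of Bałaban's is named as a Lean object, valued or asserted; no `T4Continuum/Support` leaf typed; no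
`def`, no notation; zero `sorry`.  Imports (BY NAME): (436) `…SupRemainderFlowInvariantBall` (`remainder_invariant_ball`,
`remainder_attracted`); the step files' factor shapes `t ^ 2 * n * M`, `|t| ^ 3 * n * M ^ 3`, `t ^ 4 * n * M ^ 6`, `|t| ^ 5 * n * M ^ 10`
are met BY SHAPE at `t = L⁻¹`, `n = L⁴`.

WHAT IS PROVED ([folklore]; `L M T a S μ C r : ℝ`, `K b : ℕ → ℝ`):
* §1 THE WEIGHTED FACTORS AT `d = 4`: `weighted_factor_two` (`(L⁻¹)²·L⁴·M = L²M`), `weighted_factor_three` (`|L⁻¹|³·L⁴·M³ = L·M³`),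
  `weighted_factor_four` (`(L⁻¹)⁴·L⁴·M⁶ = M⁶`), `weighted_factor_five` (`|L⁻¹|⁵·L⁴·M¹⁰ = M¹⁰∕L`).
* §2 WHICH ORDERS CONTRACT: `one_le_blockFactor` (`ϑ(x,x) = 1 ≤ ϑc(βx,βx) ≤ M·ϑ(x,x) ⟹ 1 ≤ M`), **`no_contraction_le_four`**
  (`1 < L`, `1 ≤ M ⟹ 1 < L²M ∧ 1 < LM³ ∧ 1 ≤ M⁶`), **`contraction_at_five_iff`** (`M¹⁰∕L < 1 ↔ M¹⁰ < L`), `rate_five_lt_one_iff`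
  (with the cross coefficient: `M¹⁰∕L·(1+a) < 1 ↔ M¹⁰(1+a) < L`).
* §3 READ-OFF AND THE IRRELEVANT ORBIT: `readoff_affine` (`k⁺ ≤ T(k + a·k + S) ⟹ k⁺ ≤ (T(1+a))·k + T·S`), **`irrelevant_orbit`** ((436) with
  `ν = 0`: `K_{j+1} ≤ μK_j + C`, `0 ≤ μ < 1`, `C∕(1−μ) ≤ r`, `K_0 ≤ r ⟹ K_j ≤ r ∧ K_j ≤ μ^j K_0 + C∕(1−μ)`).
* §4 THE MARGINAL AND RELEVANT ORDERS DO NOT CLOSE: **`iterated_bound_unbounded`** (`1 ≤ μ`, `0 < C`, `b_{j+1} = μb_j + C`, `0 ≤ b_0 ⟹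
  ∀ B, ∃ j, B < b_j`), `relevant_bound_unbounded` (`1 < T`, `0 < b₀ ⟹ ∀ B, ∃ j, B < T^j·b₀`).
* §5 toys (kernel): `M = 21∕20`, `L = 2`: `M¹⁰ < L` (order 5 contracts at the smallest blocking for a 5 % block factor); `M = 11∕10`: not.

HONEST (what this is NOT).  Real arithmetic on the SHAPES of the landed one-step bounds; the cross coefficient `a` and the source `S` are
NOT evaluated here (they are the h-letter × factor-letter products and the lower-order∕Gaussian terms printed in (748)–(762)); the
uniform bound on `S` along the flow IS the relevant∕marginal problem ((432)∕(434)∕(435) extraction and tuning, the β-function — B12 Thm 2 —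
for order 4) and is NOT claimed; large fields, the choice `t = L⁻¹` as the road's normalisation ((429)∕(431)) met BY SHAPE; scalar
skeleton ((A3), NC-NE7b-α UNRULED); nothing of Bałaban's asserted.  BY-NAME EFFECT ON THE WALL: NONE.  NE7b NOT PRINTED ∕ NOT PROVED;
spine PROVED 0∕9; rung (B)+1 — the programme's measures remain FINITE-torus statements; NOT the mass gap, NOT Clay.  HONEST DEPENDENCY:
continuum YM on T⁴ ⇐ BetaPertH ∧ nine spine estimates (0∕9 proved); BetaPertH ⇐ (D1) ∧ (D4) ∧ CAP+tail; G-an2-4 gates asym, D1 and NE2∕3∕4.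
-/

set_option autoImplicit false

namespace Summit.QuantumFields.BalabanUV.T4Continuum.NE7b.SupWeightedClassPowerCounting

open SupRemainderFlowInvariantBall (remainder_invariant_ball remainder_attracted)

variable {L M : ℝ}

/-! ## §1. The weighted transport factors at `d = 4` (`t = L⁻¹`, `n = L⁴`) -/

/-- **ORDER 2** ((766)∕(767): rows∕cols `≤ t²·n·M·κ`): `(L⁻¹)²·L⁴·M = L²·M`. [folklore] -/
theorem weighted_factor_two (hL : 0 < L) : (L⁻¹) ^ 2 * L ^ 4 * M = L ^ 2 * M := by
  have hL0 : L ≠ 0 := hL.ne'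
  field_simp

/-- **ORDER 3** ((766) §3∕(768): `≤ |t|³·n·M³·κ₃`): `|L⁻¹|³·L⁴·M³ = L·M³`. [folklore] -/
theorem weighted_factor_three (hL : 0 < L) : |L⁻¹| ^ 3 * L ^ 4 * M ^ 3 = L * M ^ 3 := by
  have hL0 : L ≠ 0 := hL.ne'
  rw [abs_of_pos (inv_pos.mpr hL)]
  field_simp

/-- **ORDER 4** ((770)∕(774): `≤ t⁴·n·M⁶·κ`): `(L⁻¹)⁴·L⁴·M⁶ = M⁶` — NO power of `L`: the marginal order. [folklore] -/
theorem weighted_factor_four (hL : 0 < L) : (L⁻¹) ^ 4 * L ^ 4 * M ^ 6 = M ^ 6 := by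
  have hL0 : L ≠ 0 := hL.ne'
  field_simp

/-- **ORDER 5** ((771)∕(775): `≤ |t|⁵·n·M¹⁰·κ`): `|L⁻¹|⁵·L⁴·M¹⁰ = M¹⁰∕L` — ONE inverse power of `L`: the first irrelevant order. [folklore] -/
theorem weighted_factor_five (hL : 0 < L) : |L⁻¹| ^ 5 * L ^ 4 * M ^ 10 = M ^ 10 / L := by
  have hL0 : L ≠ 0 := hL.ne'
  rw [abs_of_pos (inv_pos.mpr hL)]
  field_simp

/-! ## §2. Which orders contract -/

/-- **THE BLOCK FACTOR IS AT LEAST ONE**: on the diagonal the fine weight is `1`, the coarse weight is `≥ 1`, so `ϑc(βx,βx) ≤ M·ϑ(x,x)`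
forces `1 ≤ M`. [folklore] -/
theorem one_le_blockFactor {ϑxx ϑcyy : ℝ} (hd : ϑxx = 1) (hcd : 1 ≤ ϑcyy) (h : ϑcyy ≤ M * ϑxx) : 1 ≤ M := by
  rw [hd, mul_one] at h
  exact hcd.trans h

/-- **NO CONTRACTION AT ORDERS `≤ 4`, FOR ANY BLOCKING**: `1 < L`, `1 ≤ M ⟹` the order-2 and order-3 factors exceed `1` (indeed `≥ L`)
and the order-4 factor is `≥ 1`.  Orders 2, 3 are RELEVANT (extracted and tuned, (432)∕(434)∕(435)), order 4 is MARGINAL (the quartic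
letter: the β-function's object) — none is contracted by the class map itself. [folklore] -/
theorem no_contraction_le_four (hL : 1 < L) (hM : 1 ≤ M) : 1 < L ^ 2 * M ∧ 1 < L * M ^ 3 ∧ 1 ≤ M ^ 6 := by
  have hM3 : 1 ≤ M ^ 3 := one_le_pow₀ hM
  have hL2 : 1 < L ^ 2 := one_lt_pow₀ hL (by norm_num)
  refine ⟨?_, ?_, one_le_pow₀ hM⟩
  · calc (1 : ℝ) = 1 * 1 := (mul_one 1).symm
      _ < L ^ 2 * M := mul_lt_mul hL2 hM zero_lt_one (by positivity)
  · calc (1 : ℝ) = 1 * 1 := (mul_one 1).symm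
      _ < L * M ^ 3 := mul_lt_mul hL hM3 zero_lt_one (by positivity)

/-- **ORDER 5 CONTRACTS IFF `M¹⁰ < L`** (`L > 0`). [folklore] -/
theorem contraction_at_five_iff (hL : 0 < L) : M ^ 10 / L < 1 ↔ M ^ 10 < L := by
  rw [div_lt_one hL]

/-- **WITH THE CROSS COEFFICIENT** (the other roles of the same order enter the bound with total coefficient `a ≥ 0`): the order-5 rate
`μ = (M¹⁰∕L)·(1+a)` is `< 1` iff `M¹⁰·(1+a) < L`. [folklore] -/
theorem rate_five_lt_one_iff {a : ℝ} (hL : 0 < L) : M ^ 10 / L * (1 + a) < 1 ↔ M ^ 10 * (1 + a) < L := by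
  rw [div_mul_eq_mul_div, div_lt_one hL]

/-! ## §3. Read-off of (436)'s letters and the irrelevant orbit -/

/-- **READ-OFF**: a one-step bound of the packaged shape `k⁺ ≤ T·(k + a·k + S)` (transport factor `T ≥ 0`, own letter `k` with unit
coefficient, cross terms `a·k`, source `S`) IS (436)'s recursion with `μ = T(1+a)`, `C = T·S`, `ν = 0`. [folklore] -/
theorem readoff_affine {k k' T a S : ℝ} (hstep : k' ≤ T * (k + a * k + S)) : k' ≤ T * (1 + a) * k + T * S :=
  hstep.trans_eq (by ring)

/-- **THE IRRELEVANT ORBIT** ((436) §2–§3 at `ν = 0`): `K_{j+1} ≤ μK_j + C` with `0 ≤ μ < 1`, `C ≥ 0`, `K ≥ 0`, a radius `r ≥ C∕(1−μ)` with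
`K_0 ≤ r` ⟹ for every `j`: `K_j ≤ r` (invariant ball) and `K_j ≤ μ^j·K_0 + C∕(1−μ)` (attraction). [folklore] -/
theorem irrelevant_orbit {K : ℕ → ℝ} {μ C r : ℝ} (hμ0 : 0 ≤ μ) (hμ1 : μ < 1) (hC : 0 ≤ C) (hK0 : ∀ j, 0 ≤ K j)
    (hrec : ∀ j, K (j + 1) ≤ μ * K j + C) (hr : C / (1 - μ) ≤ r) (h0 : K 0 ≤ r) :
    ∀ j : ℕ, K j ≤ r ∧ K j ≤ μ ^ j * K 0 + C / (1 - μ) := by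
  have h1μ : 0 < 1 - μ := by linarith
  -- (436)'s hypotheses at `g ≡ 1`, `gbar = 1`, `ν = 0`
  have hg : ∀ j : ℕ, (0 : ℝ) ≤ (fun _ => (1 : ℝ)) j ∧ (fun _ => (1 : ℝ)) j ≤ 1 := fun _ => ⟨zero_le_one, le_rfl⟩
  have hrec' : ∀ j, K (j + 1) ≤ μ * K j + C * (fun _ => (1 : ℝ)) j ^ 2 + 0 * K j ^ 2 := fun j => by
    simpa using hrec j
  have hclose : μ * r + C * (1 : ℝ) ^ 2 + 0 * r ^ 2 ≤ r := by
    have : C ≤ (1 - μ) * r := by rwa [div_le_iff₀' h1μ] at hr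
    nlinarith
  have hball : ∀ j, K j ≤ r := remainder_invariant_ball hμ0 hC le_rfl hK0 hg hrec' hclose h0
  have hθ : μ + 0 * r < 1 := by simpa using hμ1
  have hattr := remainder_attracted hμ0 hC le_rfl hK0 hg hrec' hball hθ
  intro j
  refine ⟨hball j, ?_⟩
  simpa using hattr j

/-! ## §4. The marginal and relevant orders do not close -/

/-- **THE ITERATED MARGINAL BOUND IS UNBOUNDED**: with rate `μ ≥ 1` and a positive source `C`, the iterated one-step bound
`b_{j+1} = μ·b_j + C` (`b_0 ≥ 0`) exceeds every `B` — the order-4 letter is NOT controlled by the class map: it is the β-function's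
object (B12 Thm 2), not this file's. [folklore] -/
theorem iterated_bound_unbounded {b : ℕ → ℝ} {μ C : ℝ} (hμ : 1 ≤ μ) (hC : 0 < C) (h0 : 0 ≤ b 0) (hb : ∀ j, b (j + 1) = μ * b j + C) :
    ∀ B : ℝ, ∃ j : ℕ, B < b j := by
  -- linear lower bound `b_j ≥ b_0 + j·C`
  have hlow : ∀ j : ℕ, b 0 + j * C ≤ b j := by
    intro j
    induction j with
    | zero => simp
    | succ j ih =>
      have hbj : 0 ≤ b j := le_trans (by positivity) ih
      have hμb : b j ≤ μ * b j := by nlinarith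
      rw [hb j]
      push_cast
      linarith
  intro B
  obtain ⟨j, hj⟩ := exists_nat_gt (B / C)
  refine ⟨j, ?_⟩
  have hB : B < j * C := by rwa [div_lt_iff₀ hC] at hj
  linarith [hlow j]

/-- **THE RELEVANT BOUND GROWS GEOMETRICALLY**: with factor `T > 1` (orders 2, 3: `T ≥ L`) even a source-free iterated bound `T^j·b₀`
(`b₀ > 0`) exceeds every `B` — the relevant data are extracted and tuned ((432)∕(434)∕(435)), never iterated. [folklore] -/
theorem relevant_bound_unbounded {T b₀ : ℝ} (hT : 1 < T) (hb : 0 < b₀) : ∀ B : ℝ, ∃ j : ℕ, B < T ^ j * b₀ := by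
  intro B
  obtain ⟨j, hj⟩ := pow_unbounded_of_one_lt (B / b₀) hT
  exact ⟨j, by rwa [div_lt_iff₀ hb] at hj⟩

/-! ## §5. Toys -/

/-- Toy (kernel): a 5 % block factor contracts order 5 already at `L = 2`: `(21∕20)¹⁰ < 2`. -/
example : ((21 : ℝ) / 20) ^ 10 < 2 := by norm_num

/-- Toy (kernel): a 10 % block factor does not at `L = 2`: `2 < (11∕10)¹⁰`. -/
example : (2 : ℝ) < ((11 : ℝ) / 10) ^ 10 := by norm_num

/-- Toy (kernel): the order-4 factor at `L = 2`, `M = 1` is exactly `1` (marginal). -/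
example : ((2 : ℝ)⁻¹) ^ 4 * 2 ^ 4 * (1 : ℝ) ^ 6 = 1 := by norm_num

end Summit.QuantumFields.BalabanUV.T4Continuum.NE7b.SupWeightedClassPowerCounting
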